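/-
Copyright (c) 2026. All rights reserved.
Released under Apache 2.0 license as described in the file LICENSE.
Authors: abc-iut cell, seat abc-iut-w5-d019 (gen 8).
-/
import Literature.GroupTheory.ProPPowerMap
import Mathlib.GroupTheory.Nilpotent
import Mathlib.GroupTheory.Index
import Mathlib.Topology.Algebra.ClopenNhdofOne
import Mathlib.Topology.Algebra.OpenSubgroup

/-!
# Strong completeness by descent along the derived series of open subgroups
# (B. Hartley's argument for profinite groups of finite Fitting height)

B. Hartley, *Subgroups of finite index in profinite groups*, Math. Z. 168 (1979) 71–76 (Thm 1:
a topologically finitely generated profinite group with a finite normal series with pronilpotent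
factors has every subgroup of finite index open; text not held by the tree — the argument below is an
independent reconstruction of the descent for the shape needed by the cell).  Let `Γ` be a profinite
group such that

* (D) for every OPEN subgroup `H ≤ Γ`, every subgroup `L` with `⁅H, H⁆ ≤ L ≤ H` of finite index is open
  (this packages "the abstract derived subgroup `⁅H, H⁆` is closed" — uniform commutator width in the
  finite quotients, `CommutatorClosedOfBoundedWidth.lean` — together with "the topologically finitely
  generated abelian profinite group `H / cl⁅H,H⁆` is strongly complete");
* (P) there are a CLOSED subgroup `P` all of whose elements are "pro-`p`" (`σ^{p^a} → 1`: for every open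
  subgroup `W`, some `σ^{p^a} ∈ W`) and a subgroup `I` with `⁅Γ, Γ⁆ ≤ I` and `⁅I, I⁆ ≤ P`
  (`Γ/P` abstractly metabelian; for the absolute Galois group of a `p`-adic field: `I` = inertia,
  `P` = wild inertia).

Then EVERY finite-index subgroup of `Γ` is open (`isOpen_of_finiteIndex`).  Proof: pass to the normal
core `K`; descend `H ↝ K·⁅H, H⁆` through open subgroups (open by (D)); the index `[H : K]` drops unless
`H = K·⁅H,H⁆`, in which case `H/K` is a perfect finite group which (by `⁅Γ,Γ⁆ ≤ I`, `⁅I,I⁆ ≤ P`) is the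
image of the closed pro-`p` group `P ∩ H`, hence a `p`-group (abstract finite quotients of pro-`p` groups
are `p`-groups: `isPGroup_quotient_of_finiteIndex_of_proP`, seat abc-iut-w5-d218), hence nilpotent,
hence trivial (`le_of_le_sup_commutator`).

Consumer (cell abc-iut, GAP-LEDGER G-L3d2g2-1): strong completeness of `G_k = Gal(k̄/k)`, `k/ℚ_p`
finite (F-1977 / F-0412 neighbourhood), with (D) supplied by the Hartley-type width theorems
(`CommutatorWidthNilpotentNormal.lean`, `CommutatorWidthNilpotentByMetacyclic.lean`) for the finite
quotients `Gal(E/k')` (Fitting height ≤ 3) and the topological finite generation of `G_{k'}`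
(`MLFGaloisTFG`).  Classical profinite group theory; no definition, no instance; nothing here bears on
[IUTchIII] Cor. 3.12 or asserts anything about abc.

[cite: RibesZalesskii2010, §4.2] [cite: DDMSAnalyticProP1999, Thm 1.17]
-/

namespace Literature.GroupTheory

namespace StronglyCompleteOfDerivedLayers

open scoped Pointwise

section Algebra

variable {G : Type*} [Group G]

/-- A subgroup `R` with `R ≤ ⁅R, R⁆` has constant lower central series.
[cite: RibesZalesskii2010, §4.2] -/
theorem lowerCentralSeries_eq_self_of_le_commutator {R : Subgroup G} (hR : R ≤ ⁅R, R⁆) (n : ℕ) :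
    R.lowerCentralSeries n = R := by
  induction n with
  | zero => rfl
  | succ n ih => rw [Subgroup.lowerCentralSeries_succ, ih]; exact le_antisymm R.commutator_le_self hR

/-- A NILPOTENT subgroup `R` with `R ≤ ⁅R, R⁆` ("perfect") is trivial.
[cite: RibesZalesskii2010, §4.2] -/
theorem eq_bot_of_le_commutator_of_isNilpotent {R : Subgroup G} [Group.IsNilpotent R]
    (hR : R ≤ ⁅R, R⁆) : R = ⊥ := by
  obtain ⟨c, hc⟩ := (Subgroup.isNilpotent_iff_lowerCentralSeries R).mp ‹Group.IsNilpotent R›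
  rw [← lowerCentralSeries_eq_self_of_le_commutator hR c, hc]

end Algebra

section Profinite

variable {Γ : Type*} [Group Γ] [TopologicalSpace Γ] [IsTopologicalGroup Γ] [CompactSpace Γ]
  [TotallyDisconnectedSpace Γ]

/-- **Elementwise pro-`p` ⇒ pro-`p`.** If every element `σ` of a closed subgroup `P'` of a profinite
group satisfies "`σ^{p^a} ∈ W` for some `a`" for every open subgroup `W`, then every quotient of `P'`
(subspace topology) by an open normal subgroup is a `p`-group.
[cite: DDMSAnalyticProP1999, Thm 1.17] -/
theorem isPGroup_quotient_of_forall_pow_mem {p : ℕ} (P' : Subgroup Γ)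
    (hPp : ∀ σ ∈ P', ∀ W : Subgroup Γ, IsOpen (W : Set Γ) → ∃ a : ℕ, σ ^ p ^ a ∈ W)
    (U : OpenNormalSubgroup P') : IsPGroup p (P' ⧸ (U : Subgroup P')) := by
  intro q
  induction q using QuotientGroup.induction_on with
  | H g =>
    -- `U` is open for the subspace topology: `U = P' ∩ W` with `W` open in `Γ`, `1 ∈ W`
    obtain ⟨W, hWopen, hWU⟩ := isOpen_induced_iff.mp U.isOpen
    have h1W : (1 : Γ) ∈ W := by
      have h1 : (1 : P') ∈ (Subtype.val ⁻¹' W : Set P') := by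
        rw [hWU]
        exact one_mem U.toOpenSubgroup
      exact h1
    obtain ⟨V, hV⟩ := ProfiniteGrp.exist_openNormalSubgroup_sub_open_nhds_of_one hWopen h1W
    obtain ⟨a, ha⟩ := hPp g.1 g.2 V V.isOpen
    refine ⟨a, ?_⟩
    rw [← QuotientGroup.mk_pow, QuotientGroup.eq_one_iff]
    have hmem : ((g ^ p ^ a : P') : Γ) ∈ W := by
      rw [Subgroup.coe_pow]
      exact hV ha
    have : g ^ p ^ a ∈ (Subtype.val ⁻¹' W : Set P') := hmem
    rw [hWU] at this
    exact this

/-- **The perfect case.** Let `P ≤ Γ` be closed with all elements pro-`p`, `I ≤ Γ` with `⁅Γ, Γ⁆ ≤ I`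
and `⁅I, I⁆ ≤ P`.  If `H` is an open subgroup and `K ⊴ Γ` a normal subgroup of finite index with
`K ≤ H ≤ K ⊔ ⁅H, H⁆` (i.e. `H/K` is perfect), then `H ≤ K`: the perfect finite group `H/K` is the image
of the closed pro-`p` group `P ∩ H`, hence a `p`-group, hence nilpotent, hence trivial.
[cite: DDMSAnalyticProP1999, Thm 1.17] -/
theorem le_of_le_sup_commutator {p : ℕ} [Fact p.Prime] (P : Subgroup Γ) (hPc : IsClosed (P : Set Γ))
    (hPp : ∀ σ ∈ P, ∀ W : Subgroup Γ, IsOpen (W : Set Γ) → ∃ a : ℕ, σ ^ p ^ a ∈ W)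
    (I : Subgroup Γ) (hI : commutator Γ ≤ I) (hIP : ⁅I, I⁆ ≤ P)
    (H : Subgroup Γ) (hH : IsOpen (H : Set Γ)) (K : Subgroup Γ) [K.Normal] [K.FiniteIndex]
    (hperf : H ≤ K ⊔ ⁅H, H⁆) : H ≤ K := by
  -- the projection `π : Γ → Γ ⧸ K` (used as an abstract homomorphism only)
  have hK0 : K.map (QuotientGroup.mk' K) = ⊥ := by
    rw [Subgroup.map_eq_bot_iff, QuotientGroup.ker_mk']
  have h1 : H.map (QuotientGroup.mk' K) ≤ (⁅H, H⁆).map (QuotientGroup.mk' K) := by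
    calc H.map (QuotientGroup.mk' K) ≤ (K ⊔ ⁅H, H⁆).map (QuotientGroup.mk' K) := Subgroup.map_mono hperf
      _ = (⁅H, H⁆).map (QuotientGroup.mk' K) := by rw [Subgroup.map_sup, hK0, bot_sup_eq]
  have hHH : ⁅H, H⁆ ≤ H := H.commutator_le_self
  have h2 : ⁅H, H⁆ ≤ I ⊓ H := le_inf ((Subgroup.commutator_mono le_top le_top).trans hI) hHH
  have h3 : ⁅I ⊓ H, I ⊓ H⁆ ≤ P ⊓ H :=
    le_inf ((Subgroup.commutator_mono inf_le_left inf_le_left).trans hIP)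
      ((Subgroup.commutator_mono inf_le_right inf_le_right).trans hHH)
  -- `R := π(H)` satisfies `R ≤ ⁅R, R⁆` and `R = π(P ∩ H)`
  have hRR : H.map (QuotientGroup.mk' K) ≤
      ⁅H.map (QuotientGroup.mk' K), H.map (QuotientGroup.mk' K)⁆ := by
    rw [← Subgroup.map_commutator]; exact h1
  have hRI : H.map (QuotientGroup.mk' K) ≤ (I ⊓ H).map (QuotientGroup.mk' K) :=
    h1.trans (Subgroup.map_mono h2)
  have hRP : H.map (QuotientGroup.mk' K) ≤ (P ⊓ H).map (QuotientGroup.mk' K) := by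
    calc H.map (QuotientGroup.mk' K)
        ≤ ⁅H.map (QuotientGroup.mk' K), H.map (QuotientGroup.mk' K)⁆ := hRR
      _ ≤ ⁅(I ⊓ H).map (QuotientGroup.mk' K), (I ⊓ H).map (QuotientGroup.mk' K)⁆ :=
          Subgroup.commutator_mono hRI hRI
      _ = (⁅I ⊓ H, I ⊓ H⁆).map (QuotientGroup.mk' K) := (Subgroup.map_commutator _ _ _).symm
      _ ≤ (P ⊓ H).map (QuotientGroup.mk' K) := Subgroup.map_mono h3
  have hReq : (P ⊓ H).map (QuotientGroup.mk' K) = H.map (QuotientGroup.mk' K) :=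
    le_antisymm (Subgroup.map_mono inf_le_right) hRP
  -- the closed pro-`p` group `P' = P ∩ H`
  have hP'c : IsClosed ((P ⊓ H : Subgroup Γ) : Set Γ) := by
    rw [Subgroup.coe_inf]
    exact hPc.inter (Subgroup.isClosed_of_isOpen H hH)
  haveI : CompactSpace (P ⊓ H : Subgroup Γ) := isCompact_iff_compactSpace.mp hP'c.isCompact
  have hproP : ∀ U : OpenNormalSubgroup (P ⊓ H : Subgroup Γ),
      IsPGroup p ((P ⊓ H : Subgroup Γ) ⧸ (U : Subgroup (P ⊓ H : Subgroup Γ))) :=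
    isPGroup_quotient_of_forall_pow_mem (P ⊓ H) fun σ hσ => hPp σ (Subgroup.mem_inf.mp hσ).1
  -- the homomorphism `φ : P' → Γ ⧸ K` with kernel `K ∩ P'` and range `π(P')`
  have hker : ((QuotientGroup.mk' K).comp (P ⊓ H).subtype).ker = K.subgroupOf (P ⊓ H) := by
    rw [← MonoidHom.comap_ker, QuotientGroup.ker_mk']
    rfl
  have hrange : ((QuotientGroup.mk' K).comp (P ⊓ H).subtype).range =
      (P ⊓ H).map (QuotientGroup.mk' K) := by
    rw [MonoidHom.range_comp, Subgroup.range_subtype]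
  haveI : (K.subgroupOf (P ⊓ H)).FiniteIndex := by
    refine ⟨fun h0 => ?_⟩
    have hdvd : K.relIndex (P ⊓ H) ∣ K.index := Subgroup.relIndex_dvd_index_of_normal K (P ⊓ H)
    rw [Subgroup.relIndex, h0, zero_dvd_iff] at hdvd
    exact Subgroup.FiniteIndex.index_ne_zero hdvd
  have hpg : IsPGroup p ((P ⊓ H : Subgroup Γ) ⧸ K.subgroupOf (P ⊓ H)) :=
    isPGroup_quotient_of_finiteIndex_of_proP hproP (K.subgroupOf (P ⊓ H))
  haveI : Finite ((P ⊓ H : Subgroup Γ) ⧸ K.subgroupOf (P ⊓ H)) :=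
    Subgroup.finite_quotient_of_finiteIndex
  have hpg' : IsPGroup p ((P ⊓ H : Subgroup Γ) ⧸ ((QuotientGroup.mk' K).comp (P ⊓ H).subtype).ker) :=
    hpg.of_equiv (QuotientGroup.quotientMulEquivOfEq hker).symm
  haveI hfin : Finite ((P ⊓ H : Subgroup Γ) ⧸ ((QuotientGroup.mk' K).comp (P ⊓ H).subtype).ker) :=
    Finite.of_equiv _ (QuotientGroup.quotientMulEquivOfEq hker).symm.toEquiv
  have hpgR : IsPGroup p ((QuotientGroup.mk' K).comp (P ⊓ H).subtype).range :=
    hpg'.of_equiv (QuotientGroup.quotientKerEquivRange _)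
  haveI : Finite ((QuotientGroup.mk' K).comp (P ⊓ H).subtype).range :=
    Finite.of_equiv _ (QuotientGroup.quotientKerEquivRange _).toEquiv
  haveI : Group.IsNilpotent ((QuotientGroup.mk' K).comp (P ⊓ H).subtype).range := hpgR.isNilpotent
  -- the perfect nilpotent finite group `π(P') = π(H)` is trivial
  have hRR' : ((QuotientGroup.mk' K).comp (P ⊓ H).subtype).range ≤
      ⁅((QuotientGroup.mk' K).comp (P ⊓ H).subtype).range,
        ((QuotientGroup.mk' K).comp (P ⊓ H).subtype).range⁆ := by
    rw [hrange, hReq]; exact hRR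
  have hbot := eq_bot_of_le_commutator_of_isNilpotent hRR'
  rw [hrange, hReq, Subgroup.map_eq_bot_iff, QuotientGroup.ker_mk'] at hbot
  exact hbot

/-- **Strong completeness by derived-series descent.**  Let `Γ` be a profinite group such that
(D) for every open subgroup `H`, every finite-index subgroup `L` with `⁅H, H⁆ ≤ L ≤ H` is open, and
(P) there are a closed subgroup `P` with all elements pro-`p` and a subgroup `I` with `⁅Γ, Γ⁆ ≤ I`,
`⁅I, I⁆ ≤ P`.  Then every subgroup of finite index in `Γ` is open.
[cite: RibesZalesskii2010, §4.2] [cite: DDMSAnalyticProP1999, Thm 1.17] -/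
theorem isOpen_of_finiteIndex {p : ℕ} [Fact p.Prime] (P : Subgroup Γ) (hPc : IsClosed (P : Set Γ))
    (hPp : ∀ σ ∈ P, ∀ W : Subgroup Γ, IsOpen (W : Set Γ) → ∃ a : ℕ, σ ^ p ^ a ∈ W)
    (I : Subgroup Γ) (hI : commutator Γ ≤ I) (hIP : ⁅I, I⁆ ≤ P)
    (hder : ∀ H : Subgroup Γ, IsOpen (H : Set Γ) →
      ∀ L : Subgroup Γ, ⁅H, H⁆ ≤ L → L ≤ H → L.FiniteIndex → IsOpen (L : Set Γ))
    (H₀ : Subgroup Γ) [H₀.FiniteIndex] : IsOpen (H₀ : Set Γ) := by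
  -- pass to the normal core `K`
  suffices hK : IsOpen ((H₀.normalCore : Subgroup Γ) : Set Γ) from
    Subgroup.isOpen_mono (Subgroup.normalCore_le H₀) hK
  have hK0 : ∀ H : Subgroup Γ, H₀.normalCore.relIndex H ≠ 0 := by
    intro H h0
    have hdvd := Subgroup.relIndex_dvd_index_of_normal H₀.normalCore H
    rw [h0, zero_dvd_iff] at hdvd
    exact Subgroup.FiniteIndex.index_ne_zero hdvd
  -- descent: strong induction on the index of `K` in an open subgroup `H ⊇ K`
  have claim : ∀ n : ℕ, ∀ H : Subgroup Γ, IsOpen (H : Set Γ) → H₀.normalCore ≤ H →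
      H₀.normalCore.relIndex H = n → IsOpen ((H₀.normalCore : Subgroup Γ) : Set Γ) := by
    intro n
    induction n using Nat.strong_induction_on with
    | _ n ih =>
      intro H hH hKH hn
      have hHH : ⁅H, H⁆ ≤ H := H.commutator_le_self
      have hLH : H₀.normalCore ⊔ ⁅H, H⁆ ≤ H := sup_le hKH hHH
      haveI : (H₀.normalCore ⊔ ⁅H, H⁆).FiniteIndex := Subgroup.finiteIndex_of_le le_sup_left
      have hLopen : IsOpen ((H₀.normalCore ⊔ ⁅H, H⁆ : Subgroup Γ) : Set Γ) :=
        hder H hH _ le_sup_right hLH inferInstance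
      by_cases hLH' : H ≤ H₀.normalCore ⊔ ⁅H, H⁆
      · -- perfect case
        have hHK : H ≤ H₀.normalCore :=
          le_of_le_sup_commutator P hPc hPp I hI hIP H hH H₀.normalCore hLH'
        rw [le_antisymm hKH hHK]
        exact hH
      · -- the index drops
        have hmul := Subgroup.relIndex_mul_relIndex H₀.normalCore (H₀.normalCore ⊔ ⁅H, H⁆) H
          le_sup_left hLH
        have hL1 : (H₀.normalCore ⊔ ⁅H, H⁆).relIndex H ≠ 1 := fun h =>
          hLH' (Subgroup.relIndex_eq_one.mp h)
        have hL0 : (H₀.normalCore ⊔ ⁅H, H⁆).relIndex H ≠ 0 := fun h => by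
          rw [h, mul_zero] at hmul
          exact hK0 H hmul.symm
        have hlt : H₀.normalCore.relIndex (H₀.normalCore ⊔ ⁅H, H⁆) < n := by
          rw [← hn, ← hmul]
          exact lt_mul_of_one_lt_right (Nat.pos_of_ne_zero (hK0 _)) (by omega)
        exact ih _ hlt _ hLopen le_sup_left rfl
  refine claim _ ⊤ ?_ le_top rfl
  rw [Subgroup.coe_top]
  exact isOpen_univ

end Profinite

end StronglyCompleteOfDerivedLayers

end Literature.GroupTheory
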